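import Summits.BirchSwinnertonDyer.BirchSwinnertonDyer.Theorems.ErratumRoadFiveTateTorsionRigidity
import Literature.NumberTheory.EllipticCurves.TateParameterPrimeTorsion
import HarnessLib

/-!
# Route `ErratumRoadFive` (K2, `p ≥ 5`), crux (T) `Rest3TorsionBranchAtFive` (item
# stmt-BirchSwinnertonDyer-19702): torsion rigidity of the Tate curve OVER `ℚ_p`, `p` ODD — Lemma (L1) of
# THEOREM T♭ in the form the memo uses it (`E_q(L)[p^∞] = E_q(ℚ_p)[p^∞] ≅ ℤ/p^k` for `L/ℚ_p` normal pro-`p`)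

Cell `bsd-stepL` (run/shared/lean/pub/bsd-stepL/), seat `bsd-stepL-bdp` (prover g14, 2026-08-26), memo
`HOME/proof/PROOF-BDP.md` §31–§32; `--supports stmt-BirchSwinnertonDyer-19702 --as helper`. Companion of
`ErratumRoadFiveTateTorsionRigidity.lean` (the abstract statement over any complete ultrametric `K` of
characteristic `0`), specialised to `K = ℚ_p` with the two `ℚ_p`-facts the memo quotes:

* `μ_p(ℚ_p) = 1` for odd `p` — the tree's THEOREM
  `Literature.NumberTheory.EllipticCurves.TatePrimeTorsion.eq_one_of_pow_prime_eq_one` (Serre, *Cours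
  d'arithmétique* II §3); with §2 of the companion, `μ_p(L) = 1` for every `L = ℚ̄_p^H` whose elements have
  `p`-power degree over `ℚ_p` (`H ⊴ G_{ℚ_p}`);
* `exists_eq_pow_prime_pow_and_not_pow` — every `q ∈ ℚ_p` with `0 < ‖q‖ < 1` is `r ^ p ^ k` with `r` NOT
  a `p`-th power in `ℚ_p` (the `p`-power divisibility of `q` in `ℚ_p^×` is bounded by `v_p(q)`; PROVED here
  from Mathlib's `Padic.valuation`): `k = max{j : q ∈ (ℚ_p^×)^{p^j}}`, so `E_q(ℚ_p)[p^∞] ≅ ℤ/p^k`.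

Main results (`tateCurve q` over `ℚ_p`, `p` an odd prime, `0 < ‖q‖ < 1`, `H ⊴ G_{ℚ_p}` a normal subgroup
all of whose fixed elements in `ℚ̄_p` have `p`-power degree — e.g. `ℚ̄_p^H = K_{∞,w}`, the anticyclotomic
local tower, a `ℤ_p`-extension of `K_𝔭 = ℚ_p`):
* `padic_smul_eq_self_of_fixed_of_torsion` — **every `H`-fixed `p`-power-torsion point of `E_q(ℚ̄_p)` is
  `G_{ℚ_p}`-fixed**: `E_q(K_{∞,w})[p^∞] = E_q(ℚ_p)[p^∞]` (memo §31.2 Lemma (L1), verbatim);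
* `padic_exists_generator_fixed_torsion` — there are `k : ℕ` and ONE `G_{ℚ_p}`-fixed point `P₀` of exact
  order `p^k` such that every such point is a multiple of `P₀`: `#E_q(K_{∞,w})[p^∞] = p^k` uniformly in
  the layer — the constant `c₀ = k·d·s` of memo §31.2 (E).

HONEST FRAMING: theorems only (no definition, no named fact, no `sorry`), fact-free (Tate's
uniformisation is the tree's theorem `uniformization_holds`); nothing about Selmer groups or preprints is
asserted; nothing is booked; no census word, tier or label moves (T7). NOT here: the dictionary between a
curve `E/ℚ` split multiplicative at `p` and `tateCurve q_E` over `ℚ_p` (ATAEC V.5.3, the tree's named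
facts `isomorphic_tateCurve_of_one_lt_norm_j` ∕ `splitMultiplicative_tfae`), nor the identification of
`K_{∞,w}` with a fixed field `ℚ̄_p^H` of the stated kind (standard: a `ℤ_p`-extension is Galois, pro-`p`).

References: [SilvermanATAEC1994] Thm. V.3.1 (c),(d) (PDF pp. 395–399); [Serre1973] Ch. II §3 Prop. 8,
Thm. 2; [Castella2018Erratum] Lemma 2.1, Remark (2); memo PROOF-BDP §31.2, §32.
-/

set_option autoImplicit false
-- the Theorems namespace of this sub repeats the summit name by design (D-0017 nested layout)
set_option linter.dupNamespace false

noncomputable section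

open scoped Classical

namespace Summit.BirchSwinnertonDyer.BirchSwinnertonDyer.Theorems.TateTorsionRigidity

open Field WeierstrassCurve Literature.NumberTheory.EllipticCurves
  Literature.NumberTheory.EllipticCurves.TateCurve Literature.NumberTheory.EllipticCurves.SteinWuthrich2013

variable {p : ℕ} [Fact p.Prime]

/-! ### §1 `q = r ^ p ^ k` with `r ∉ (ℚ_p^×)^p` -/

/-- `‖q‖ < 1` for a non-zero `q ∈ ℚ_p` means `0 < v_p(q)`. [folklore] -/
theorem padic_valuation_pos_of_norm_lt_one {q : ℚ_[p]} (hq0 : q ≠ 0) (hq1 : ‖q‖ < 1) :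
    0 < q.valuation := by
  by_contra h
  push Not at h
  have hp1 : (1 : ℝ) ≤ p := by exact_mod_cast (Fact.out : p.Prime).one_lt.le
  have h1 : (1 : ℝ) ≤ ‖q‖ := by
    rw [Padic.norm_eq_zpow_neg_valuation hq0]
    exact one_le_zpow₀ hp1 (by omega)
  exact absurd (h1.trans_lt hq1) (lt_irrefl _)

/-- **Every `q ∈ ℚ_p` with `0 < ‖q‖ < 1` is `r ^ p ^ k` with `r` NOT a `p`-th power in `ℚ_p`** (so
`0 < ‖r‖ < 1` as well): the `p`-power divisibility of `q` in `ℚ_p^×` is bounded, since `s ^ p ^ j = q`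
forces `p ^ j ∣ v_p(q)` with `v_p(q) ≥ 1`, i.e. `p ^ j ≤ v_p(q)`. (Then `E_q(ℚ_p)[p^∞] ≅ ℤ/p^k` by Tate's
uniformisation and `μ_p(ℚ_p) = 1`.) [folklore] -/
theorem exists_eq_pow_prime_pow_and_not_pow (q : ℚ_[p]) (hq0 : q ≠ 0) (hq1 : ‖q‖ < 1) :
    ∃ (k : ℕ) (r : ℚ_[p]), q = r ^ p ^ k ∧ ∀ s : ℚ_[p], s ^ p ≠ r := by
  have hp : p.Prime := Fact.out
  by_contra! h
  -- then `q` has `p^j`-th roots for every `j`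
  have hall : ∀ j : ℕ, ∃ s : ℚ_[p], s ^ p ^ j = q := by
    intro j
    induction j with
    | zero => exact ⟨q, by rw [pow_zero, pow_one]⟩
    | succ j ih =>
      obtain ⟨s, hs⟩ := ih
      obtain ⟨t, ht⟩ := h j s hs.symm
      exact ⟨t, by rw [pow_succ', pow_mul, ht, hs]⟩
  have hvq : 0 < q.valuation := padic_valuation_pos_of_norm_lt_one hq0 hq1
  -- take `j` with `p ^ j > v_p(q)`
  obtain ⟨s, hs⟩ := hall q.valuation.natAbs
  have hs0 : s ≠ 0 := by
    rintro rfl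
    rw [zero_pow (pow_ne_zero _ hp.ne_zero)] at hs
    exact hq0 hs.symm
  have hv : q.valuation = (p ^ q.valuation.natAbs : ℕ) * s.valuation := by
    have h := Padic.valuation_pow s (p ^ q.valuation.natAbs)
    rwa [hs] at h
  have hvs : 0 < s.valuation := by
    rcases lt_trichotomy s.valuation 0 with hlt | heq | hgt
    · exfalso
      have : q.valuation < 0 := by
        rw [hv]; exact mul_neg_of_pos_of_neg (by exact_mod_cast pow_pos hp.pos _) hlt
      omega
    · exfalso; rw [hv, heq, mul_zero] at hvq; exact lt_irrefl _ hvq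
    · exact hgt
  have hle : ((p ^ q.valuation.natAbs : ℕ) : ℤ) ≤ q.valuation := by
    calc ((p ^ q.valuation.natAbs : ℕ) : ℤ) = (p ^ q.valuation.natAbs : ℕ) * 1 := by rw [mul_one]
      _ ≤ (p ^ q.valuation.natAbs : ℕ) * s.valuation :=
          mul_le_mul_of_nonneg_left (by omega) (by positivity)
      _ = q.valuation := hv.symm
  have hlt : q.valuation.natAbs < p ^ q.valuation.natAbs := Nat.lt_pow_self hp.one_lt
  omega

/-! ### §2 Torsion rigidity of `E_q` over `ℚ_p`, `p` odd -/

/-- **`μ_p(ℚ̄_p^H) = 1`** for `p` odd and `H ≤ G_{ℚ_p}` all of whose fixed elements have `p`-power degree over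
`ℚ_p` (the companion's `fixed_pow_prime_eq_one_of_degree` with `μ_p(ℚ_p) = 1`, the tree's
`TatePrimeTorsion.eq_one_of_pow_prime_eq_one`, Serre II §3). [cite: Serre1973, Ch. II §3.2 Thm. 2] -/
theorem padic_fixed_pow_prime_eq_one (hp2 : p ≠ 2) (H : Subgroup (absoluteGaloisGroup ℚ_[p]))
    (hdeg : ∀ x : AlgebraicClosure ℚ_[p], (∀ τ ∈ H, τ • x = x) →
      ∃ j : ℕ, (minpoly ℚ_[p] x).natDegree = p ^ j)
    (ζ : AlgebraicClosure ℚ_[p]) (hfix : ∀ τ ∈ H, τ • ζ = ζ) (hζ : ζ ^ p = 1) : ζ = 1 :=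
  fixed_pow_prime_eq_one_of_degree (Fact.out : p.Prime) H
    (fun z hz => TatePrimeTorsion.eq_one_of_pow_prime_eq_one hp2 z hz) hdeg ζ hfix hζ

/-- **Lemma (L1) of THEOREM T♭ over `ℚ_p` (memo §31.2, PROVED in the kernel).** `p` an odd prime,
`q ∈ ℚ_p` with `0 < ‖q‖ < 1`, `H ⊴ G_{ℚ_p}` a normal subgroup all of whose fixed elements in `ℚ̄_p` have
`p`-power degree over `ℚ_p` (e.g. `ℚ̄_p^H = K_{∞,w}`, a `ℤ_p`-extension of `ℚ_p`). Then every `H`-fixed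
`p`-power-torsion point of the Tate curve `E_q(ℚ̄_p)` is `G_{ℚ_p}`-fixed:
**`E_q(ℚ̄_p^H)[p^∞] = E_q(ℚ_p)[p^∞]`** — «a Tate curve over `ℚ_p` acquires no new `p`-power torsion in an
abelian pro-`p` extension of `ℚ_p`, `p` odd». [cite: SilvermanATAEC1994, Thm. V.3.1 (c),(d) (PDF pp. 395–399)] -/
theorem padic_smul_eq_self_of_fixed_of_torsion (hp2 : p ≠ 2) (q : ℚ_[p]) (hq0 : q ≠ 0) (hq1 : ‖q‖ < 1)
    (H : Subgroup (absoluteGaloisGroup ℚ_[p])) [H.Normal]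
    (hdeg : ∀ x : AlgebraicClosure ℚ_[p], (∀ τ ∈ H, τ • x = x) →
      ∃ j : ℕ, (minpoly ℚ_[p] x).natDegree = p ^ j)
    (P : geomPoints (tateCurve q)) {n : ℕ} (hP : (p ^ n) • P = 0) (hfix : ∀ τ ∈ H, τ • P = P)
    (σ : absoluteGaloisGroup ℚ_[p]) : σ • P = P := by
  have hp : p.Prime := Fact.out
  obtain ⟨k, r, rfl, hr⟩ := exists_eq_pow_prime_pow_and_not_pow q hq0 hq1
  have hr0 : r ≠ 0 := by rintro rfl; exact hq0 (zero_pow (pow_ne_zero _ hp.ne_zero))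
  have hr1 : ‖r‖ < 1 := by
    rw [norm_pow] at hq1
    exact (pow_lt_one_iff_of_nonneg (norm_nonneg r) (pow_ne_zero _ hp.ne_zero)).mp hq1
  exact smul_eq_self_of_fixed_of_torsion hp hr0 hr1 hr k H (padic_fixed_pow_prime_eq_one hp2 H hdeg)
    P hP hfix σ

/-- **(L1), structure form over `ℚ_p`: `E_q(ℚ̄_p^H)[p^∞] = E_q(ℚ_p)[p^∞] ≅ ℤ/p^k` on ONE `ℚ_p`-rational
generator, `k` depending on `q` alone** (not on `H`): under the hypotheses of
`padic_smul_eq_self_of_fixed_of_torsion` there are `k : ℕ` and a `G_{ℚ_p}`-fixed `P₀ ∈ E_q(ℚ̄_p)` of exact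
order `p ^ k` such that every `H`-fixed `p`-power-torsion point is an integer multiple of `P₀`. The
bound `#H⁰(K_{∞,w}, E[p^∞]) = p^k`, uniform in the layer, is the constant of memo §31.2 (E).
[cite: SilvermanATAEC1994, Thm. V.3.1 (c),(d) (PDF pp. 395–399)] -/
theorem padic_exists_generator_fixed_torsion (hp2 : p ≠ 2) (q : ℚ_[p]) (hq0 : q ≠ 0) (hq1 : ‖q‖ < 1)
    (H : Subgroup (absoluteGaloisGroup ℚ_[p])) [H.Normal]
    (hdeg : ∀ x : AlgebraicClosure ℚ_[p], (∀ τ ∈ H, τ • x = x) →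
      ∃ j : ℕ, (minpoly ℚ_[p] x).natDegree = p ^ j) :
    ∃ (k : ℕ) (P₀ : geomPoints (tateCurve q)),
      (∀ σ : absoluteGaloisGroup ℚ_[p], σ • P₀ = P₀) ∧ (p ^ k) • P₀ = 0 ∧
      (∀ j : ℕ, j • P₀ = 0 → p ^ k ∣ j) ∧
      ∀ (P : geomPoints (tateCurve q)) (n : ℕ), (p ^ n) • P = 0 →
        (∀ τ ∈ H, τ • P = P) → ∃ j : ℤ, P = j • P₀ := by
  have hp : p.Prime := Fact.out
  obtain ⟨k, r, rfl, hr⟩ := exists_eq_pow_prime_pow_and_not_pow q hq0 hq1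
  have hr0 : r ≠ 0 := by rintro rfl; exact hq0 (zero_pow (pow_ne_zero _ hp.ne_zero))
  have hr1 : ‖r‖ < 1 := by
    rw [norm_pow] at hq1
    exact (pow_lt_one_iff_of_nonneg (norm_nonneg r) (pow_ne_zero _ hp.ne_zero)).mp hq1
  exact ⟨k, exists_generator_fixed_torsion hp hr0 hr1 hr k H (padic_fixed_pow_prime_eq_one hp2 H hdeg)⟩

end Summit.BirchSwinnertonDyer.BirchSwinnertonDyer.Theorems.TateTorsionRigidity

end
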